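import Summits.ResolutionOfSingularities.ResolutionOfSingularities.Theorems.HomologicalConductorNoZenoBeta1Trdeg3
import Summits.ResolutionOfSingularities.ResolutionOfSingularities.Theorems.HomologicalConductorNoZenoCaPrincipalReductions
import Literature.AlgebraicGeometry.Resolution.AffineModelLU
import Literature.AlgebraicGeometry.Resolution.AdicCompletionRegular
import HarnessLib

/-!
# Crux `NoZenoR` (stmt-ResolutionOfSingularities-19943), slot 2, tr.deg-3 half `Exh3`:
# THE EXCEPTIONAL EQUATION IN THE CONDUCTOR — a regular local ring caught under a stage forces an element of positive value into `√ca`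

OURS (cell res-hironaka, crux chain W4.4; lead res-L0-w44-lead-1 g10, DESK WORD 40 OBJECT 2-T, CRUX-PLAN v7 §2 slot 2 (2-i)).
AI-written, weaker than expert review; nothing here is a statement of the manuscript under review (Hironaka 2017).  SUPPORT-level,
counted 0.  Def-free; Iyengar–Takahashi's Theorem 5.4 enters through the tree's PROVED `singEqVCa_essFiniteType_holds`
(via `NoZeno.Birth.exists_coe_mem_ca_not_mem`).

* `excEquation_pow_mem_ca` — for a regular local `k`-subalgebra `R ⊆ O` of `K` with `Frac R = K`, `loc O R = R`, caught under a stage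
  `R ≤ T_M` of the canonical `ca`-tower: EITHER `T_M` is regular (indeed `T_M = R`), OR some non-zero `g ∈ R` of POSITIVE value has a power
  in `ca(T_M)`.  Proof: `T_M = loc O B`, `B = k[x_1, …, x_n]`, `x_i = a_i / g_i` over `R`, `g := ∏ g_i`.  If `g` is an `O`-unit every
  `g_i⁻¹ ∈ loc O R = R`, so `B ≤ R` and `T_M = loc O B ≤ loc O R = R`.  Otherwise `v(g) > 0`, and for every prime `𝔭 ∌ g` of `T_M` the
  sandwich `R ⊆ T_M ⊆ R_{𝔭 ∩ R}` (denominators are `O`-units times powers of `g`) makes `(T_M)_𝔭` regular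
  (`isRegularLocalRing_localization_of_sandwich`), so `ca(T_M) ⊄ 𝔭` (Theorem 5.4); hence `g ∈ √ca(T_M)`.
* `exh3_excEquation` — the Exh3 reading (modulo `CossartPiltant2019LU3` through `Beta1Trdeg3.exh3_interlaced`): an exhausting tr.deg-3
  tower either terminates or, above every stage `T_m`, has a later stage `T_M ⊇ R ⊇ T_m` (`R` regular) and `g ∈ R`, `v(g) > 0`,
  `g^N ∈ ca(T_M)` — interlacing converted into VALUE information (`γ_M := min v(ca T_M) ≤ N · v(g)` with `g` in a regular ring between
  `T_m` and `T_M`).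

References: S. Iyengar, R. Takahashi, IMRN 2016, Thm. 5.4 [`IyengarTakahashi2014`]; H. Matsumura, *Commutative Ring Theory*, Thm. 19.3
[`Matsumura1987`]; V. Cossart, O. Piltant, J. Algebra 529 (2019), Thm. 1.1 [`CossartPiltant2019`] (named fact, hypothesis of the corollary).
-/

noncomputable section

-- single-problem summit: the doubled namespace component `ResolutionOfSingularities` is forced
set_option linter.dupNamespace false

namespace Summit.ResolutionOfSingularities.ResolutionOfSingularities.Theorems.NoZeno.ExcEquation

open Summit.ResolutionOfSingularities.ResolutionOfSingularities.Theses.HomologicalConductor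
open Summit.ResolutionOfSingularities.ResolutionOfSingularities.Theorems.NoZeno.Birth
open Summit.ResolutionOfSingularities.ResolutionOfSingularities.Theorems
open Summit.ResolutionOfSingularities.ResolutionOfSingularities.Theorems.NoZeno
open Literature.AlgebraicGeometry.Resolution
open IsLocalRing Polynomial

variable {k K : Type} [Field k] [Field K] [Algebra k K]

/-! ## Plumbing: `loc` is monotone; an element of a prime's radical-complement -/

/-- `loc O ·` is monotone. [folklore] -/
theorem loc_mono (O : ValuationSubring K) {B C : Subalgebra k K} (h : B ≤ C) : loc O B ≤ loc O C := by
  refine Algebra.adjoin_mono ?_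
  rintro y ⟨a, ha, s, hs, hsO, rfl⟩
  exact ⟨a, h ha, s, h hs, hsO, rfl⟩

/-- Clearing denominators over `R`: if every generator `x ∈ S` has `x * g ∈ R` (`g ∈ R`), then every element of `k[S]` is carried
into `R` by a power of `g`. [folklore] -/
theorem exists_mul_pow_mem_of_adjoin (R : Subalgebra k K) {S : Set K} {g : K} (hg : g ∈ R)
    (hS : ∀ x ∈ S, x * g ∈ R) {b : K} (hb : b ∈ Algebra.adjoin k S) : ∃ e : ℕ, b * g ^ e ∈ R := by
  induction hb using Algebra.adjoin_induction with
  | mem x hx => exact ⟨1, by rw [pow_one]; exact hS x hx⟩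
  | algebraMap c => exact ⟨0, by rw [pow_zero, mul_one]; exact R.algebraMap_mem c⟩
  | add x y _ _ hx hy =>
    obtain ⟨e₁, h₁⟩ := hx
    obtain ⟨e₂, h₂⟩ := hy
    refine ⟨e₁ + e₂, ?_⟩
    have : (x + y) * g ^ (e₁ + e₂) = x * g ^ e₁ * g ^ e₂ + y * g ^ e₂ * g ^ e₁ := by ring
    rw [this]
    exact R.add_mem (R.mul_mem h₁ (R.pow_mem hg _)) (R.mul_mem h₂ (R.pow_mem hg _))
  | mul x y _ _ hx hy =>
    obtain ⟨e₁, h₁⟩ := hx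
    obtain ⟨e₂, h₂⟩ := hy
    refine ⟨e₁ + e₂, ?_⟩
    have : x * y * g ^ (e₁ + e₂) = (x * g ^ e₁) * (y * g ^ e₂) := by ring
    rw [this]
    exact R.mul_mem h₁ h₂

/-! ## The exceptional equation -/

/-- **THE EXCEPTIONAL EQUATION IN THE CONDUCTOR.**  Let `R ⊆ O` be a regular local `k`-subalgebra of `K` with `Frac R = K` and
`loc O R = R` (its `O`-units are units), caught under a stage of the canonical normalised `ca`-tower: `R ≤ T_M`.  Then EITHER `T_M` is a
regular local ring, OR there is a non-zero `g ∈ R` of POSITIVE value (`O.valuation g < 1`) with `g ^ N ∈ ca(T_M)` for some `N ≥ 1` — the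
equation of the exceptional locus of `Spec T_M → Spec R` lies in the radical of the cohomology annihilator.  Proof: write `T_M = loc O B`,
`B = k[x_1, …, x_n]` (tree `StrictDrop.Birth.TowerShape.stub_towerShape`), `x_i = a_i / g_i` over `R`, `g := ∏ g_i ∈ R ∖ 0`.  If `g⁻¹ ∈ O`
then every `g_i⁻¹ ∈ loc O R = R`, `B ≤ R`, `T_M = loc O B ≤ loc O R = R ≤ T_M`, so `T_M = R` is regular.  Else `v(g) > 0`; for a prime
`𝔭` of `T_M` with `g ∉ 𝔭`, every `t = b u⁻¹ ∈ T_M` (`b, u ∈ B`, `u` an `O`-unit) satisfies `t · (u g^e) = b g^e` with `u g^e, b g^e ∈ R`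
and `u g^e ∉ 𝔭`, so `(T_M)_𝔭 = R_{𝔭 ∩ R}` is regular (`isRegularLocalRing_localization_of_sandwich`, Matsumura 19.3); by Theorem 5.4
(`exists_coe_mem_ca_not_mem`, the tree's `singEqVCa_essFiniteType_holds`) `ca(T_M) ⊄ 𝔭`.  So `g` lies in every prime containing
`ca(T_M)`, i.e. in its radical. [this work; cite: IyengarTakahashi2014, Thm. 5.4; Matsumura1987, Thm. 19.3] -/
theorem excEquation_pow_mem_ca (p : ℕ) (hp : p.Prime) (k K : Type) [Field k] [CharP k p] [Field K] [Algebra k K]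
    (O : ValuationSubring K) (A : Subalgebra k K) (hk : ∀ c : k, algebraMap k K c ∈ O) (hA : A.FG)
    (hfr : IsFractionRing ↥A K) (hAO : A.toSubring ≤ O.toSubring) {R : Subalgebra k K} (hR : IsRegularLocalRing ↥R)
    (hRfr : IsFractionRing ↥R K) (hRO : R.toSubring ≤ O.toSubring) (hlocR : loc O R = R) {M : ℕ}
    (hRM : R ≤ tower O A M) :
    IsRegularLocalRing ↥(tower O A M) ∨
      ∃ g : K, g ∈ R ∧ g ≠ 0 ∧ O.valuation g < 1 ∧ ∃ N : ℕ, 0 < N ∧ g ^ N ∈ ca (tower O A M) := by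
  classical
  haveI := hRfr
  -- a finitely generated presentation `T_M = loc O B`, `B = k[SB]`
  have hshape : (∃ B : Subalgebra k K, B.FG ∧ B ≤ tower O A M ∧
      loc O B = tower O A M ∧ ∀ x ∈ tower O A M, ∃ b ∈ B, ∃ s ∈ B, s⁻¹ ∈ O ∧ x = b * s⁻¹) ∧
      IsNoetherianRing ↥(tower O A M) ∧ (tower O A M).toSubring ≤ O.toSubring ∧
      ∀ s ∈ tower O A M, s⁻¹ ∈ O → s⁻¹ ∈ tower O A M :=
    StrictDrop.Birth.TowerShape.stub_towerShape p hp k K O A hk hA hfr hAO M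
  obtain ⟨⟨B, ⟨SB, hSB⟩, hBT, hlocB, hfrac⟩, -, hTO, hinvT⟩ := hshape
  -- generators as fractions over `R`: `x = num x / den x`
  have hfr' : ∀ x : K, ∃ a g : K, a ∈ R ∧ g ∈ R ∧ g ≠ 0 ∧ x = a / g := fun x => by
    obtain ⟨a, b, hb, rfl⟩ := IsFractionRing.div_surjective (A := ↥R) x
    exact ⟨a, b, a.2, b.2, by exact_mod_cast nonZeroDivisors.ne_zero hb, rfl⟩
  choose num den hnum hden hden0 hxeq using hfr'
  -- the common denominator `g = ∏_{x ∈ SB} den x ∈ R ∖ 0`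
  set g : K := ∏ x ∈ SB, den x with hgdef
  have hgR : g ∈ R := Subalgebra.prod_mem R fun x _ => hden x
  have hg0 : g ≠ 0 := Finset.prod_ne_zero_iff.mpr fun x _ => hden0 x
  have hgO : g ∈ O := hRO (Subalgebra.mem_toSubring.mpr hgR)
  -- `x * g ∈ R` for every generator `x ∈ SB`
  have hSg : ∀ x ∈ (SB : Set K), x * g ∈ R := by
    intro x hx
    have hx' : x ∈ SB := Finset.mem_coe.mp hx
    rw [hgdef, ← Finset.mul_prod_erase SB den hx', ← mul_assoc]
    have h1 : x * den x = num x := (eq_div_iff (hden0 x)).mp (hxeq x)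
    rw [h1]
    exact R.mul_mem (hnum x) (Subalgebra.prod_mem R fun y _ => hden y)
  by_cases hginv : g⁻¹ ∈ O
  · -- CASE `g` an `O`-unit: `B ≤ R`, `T_M = R`
    left
    have hSBR : (SB : Set K) ⊆ R := by
      intro x hx
      have hx' : x ∈ SB := Finset.mem_coe.mp hx
      -- `(den x)⁻¹ = g⁻¹ * ∏_{y ≠ x} den y ∈ O`, hence `∈ loc O R = R`
      have hdinvO : (den x)⁻¹ ∈ O := by
        have hP0 : (∏ y ∈ SB.erase x, den y) ≠ 0 := Finset.prod_ne_zero_iff.mpr fun y _ => hden0 y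
        have hgx : g = den x * ∏ y ∈ SB.erase x, den y := by rw [hgdef, Finset.mul_prod_erase SB den hx']
        have : (den x)⁻¹ = g⁻¹ * ∏ y ∈ SB.erase x, den y := by
          rw [hgx, mul_inv_rev, mul_assoc, mul_comm (den x)⁻¹, ← mul_assoc, inv_mul_cancel₀ hP0, one_mul]
        rw [this]
        exact O.mul_mem _ _ hginv (by
          have : (∏ y ∈ SB.erase x, den y) ∈ R := Subalgebra.prod_mem R fun y _ => hden y
          exact hRO (Subalgebra.mem_toSubring.mpr this))
      have hdinvR : (den x)⁻¹ ∈ R := by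
        rw [← hlocR]
        exact Algebra.subset_adjoin ⟨1, R.one_mem, den x, hden x, hdinvO, by rw [one_mul]⟩
      rw [SetLike.mem_coe, hxeq x, div_eq_mul_inv]
      exact R.mul_mem (hnum x) hdinvR
    have hBR : B ≤ R := by rw [← hSB]; exact Algebra.adjoin_le hSBR
    have hTR : tower O A M ≤ R := by
      rw [← hlocB]
      calc loc O B ≤ loc O R := loc_mono O hBR
        _ = R := hlocR
    have hEq : R = tower O A M := le_antisymm hRM hTR
    rw [← hEq]; exact hR
  · -- CASE `v(g) > 0`: `g ∈ √ca(T_M)`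
    right
    have hvg : O.valuation g < 1 := by
      by_contra h
      push Not at h
      have h1 : O.valuation g = 1 := le_antisymm ((O.valuation_le_one_iff g).mpr hgO) h
      exact hginv ((O.valuation_le_one_iff _).mp (by rw [map_inv₀, h1, inv_one]))
    refine ⟨g, hgR, hg0, hvg, ?_⟩
    -- the stage and the element `g` inside it
    set T : Subalgebra k K := tower O A M with hTdef
    haveI : IsNoetherianRing ↥T := stub_towerNoetherian k K O A hk hA hfr hAO M
    let gT : ↥T := ⟨g, hRM hgR⟩
    -- every `b ∈ B` is carried into `R` by a power of `g`
    have hBg : ∀ b ∈ B, ∃ e : ℕ, b * g ^ e ∈ R := fun b hb =>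
      exists_mul_pow_mem_of_adjoin R hgR hSg (by rw [hSB]; exact hb)
    -- KEY: a prime of `T` not containing `g` has regular localisation
    have hregJ : ∀ (J : Ideal ↥T) [J.IsPrime], gT ∉ J → IsRegularLocalRing (Localization.AtPrime J) := by
      intro J _ hgJ
      have hle : R.toSubring ≤ T.toSubring := fun x hx => hRM hx
      haveI : IsFractionRing ↥R.toSubring K := hRfr
      let P' : Ideal ↥R.toSubring := J.comap (Subring.inclusion hle)
      haveI : P'.IsPrime := Ideal.IsPrime.comap _
      haveI : IsRegularLocalRing ↥R.toSubring := hR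
      refine isRegularLocalRing_localization_of_sandwich (K := K) (T := T.toSubring) hle J P' rfl ?_
        (isRegularLocalRing_localization_atPrime (↥R.toSubring) P')
      -- the sandwich: `t · (u g^e) = b g^e` with `u g^e ∉ J`
      intro t
      obtain ⟨b, hb, u, hu, huO, htbu⟩ := hfrac t t.2
      obtain ⟨e₁, he₁⟩ := hBg b hb
      obtain ⟨e₂, he₂⟩ := hBg u hu
      have huT : u ∈ T := hBT hu
      by_cases hu0 : u = 0
      · refine ⟨0, 1, ?_, ?_⟩
        · change (1 : ↥T) ∉ J
          exact J.ne_top_iff_one.mp (Ideal.IsPrime.ne_top inferInstance)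
        · have : (t : K) = 0 := by rw [htbu, hu0, inv_zero, mul_zero]
          simp [this]
      have hsR : u * g ^ (e₁ + e₂) ∈ R := by
        rw [pow_add, mul_comm (g ^ e₁), ← mul_assoc]; exact R.mul_mem he₂ (R.pow_mem hgR _)
      have haR : b * g ^ (e₁ + e₂) ∈ R := by
        rw [pow_add, ← mul_assoc]; exact R.mul_mem he₁ (R.pow_mem hgR _)
      refine ⟨⟨b * g ^ (e₁ + e₂), haR⟩, ⟨u * g ^ (e₁ + e₂), hsR⟩, ?_, ?_⟩
      · -- `u` is a unit of `T` (an `O`-unit of `loc O B`), `g ∉ J`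
        have huunit : (⟨u, huT⟩ : ↥T) ∉ J := by
          intro hmem
          have hinv : u⁻¹ ∈ T := hinvT u huT huO
          have h1 : (⟨u, huT⟩ : ↥T) * ⟨u⁻¹, hinv⟩ = 1 := Subtype.ext (mul_inv_cancel₀ hu0)
          exact (Ideal.IsPrime.ne_top inferInstance) (J.eq_top_of_isUnit_mem hmem (IsUnit.of_mul_eq_one _ h1))
        have hgpow : gT ^ (e₁ + e₂) ∉ J := fun h => hgJ (Ideal.IsPrime.mem_of_pow_mem inferInstance _ h)
        have hprod := (Ideal.IsPrime.mul_notMem inferInstance) huunit hgpow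
        have heq : Subring.inclusion hle ⟨u * g ^ (e₁ + e₂), hsR⟩ = (⟨u, huT⟩ : ↥T) * gT ^ (e₁ + e₂) :=
          Subtype.ext (by simp [gT])
        rw [heq]; exact hprod
      · change (t : K) * (u * g ^ (e₁ + e₂)) = b * g ^ (e₁ + e₂)
        rw [htbu, mul_assoc, ← mul_assoc u⁻¹, inv_mul_cancel₀ hu0, one_mul]
    -- Theorem 5.4: `ca(T) ⊄ J` for such primes, so `g ∈ √ca(T)`
    have hrad : gT ∈ (Literature.RingTheory.CohomologyAnnihilator.cohomologyAnnihilator ↥T).radical := by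
      rw [Ideal.radical_eq_sInf, Submodule.mem_sInf]
      rintro J ⟨hIJ, hJ⟩
      haveI : Ideal.IsPrime J := hJ
      by_contra hgJ
      obtain ⟨c, hc, hcJ⟩ := exists_coe_mem_ca_not_mem O A hk hA hfr hAO M J (hregJ J hgJ)
      exact hcJ (hIJ ((tn_coe_mem_ca_iff T c).mp hc))
    obtain ⟨n, hn⟩ := hrad
    refine ⟨n + 1, Nat.succ_pos n, ?_⟩
    have hmem : gT ^ (n + 1) ∈ Literature.RingTheory.CohomologyAnnihilator.cohomologyAnnihilator ↥T := by
      rw [pow_succ]; exact Ideal.mul_mem_right _ _ hn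
    have := (tn_coe_mem_ca_iff T (gT ^ (n + 1))).mpr hmem
    simpa using this

/-! ## The Exh3 reading: interlacing gives value information -/

/-- **EXCEPTIONAL EQUATIONS ALONG AN EXHAUSTING TOWER (tr.deg ≤ 3, modulo `CossartPiltant2019LU3`).**  If the canonical `ca`-tower of a
datum of transcendence degree `≤ 3` EXHAUSTS `O`, then either some stage is regular, or above EVERY stage `T_m` there are a later stage
`T_M` (`m < M`), a REGULAR local ring `R` with `T_m ≤ R ≤ T_M`, and a non-zero `g ∈ R` of positive value with `g ^ N ∈ ca(T_M)`, `N ≥ 1`: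
the interlacing of `Interlacing.exists_regular_between_stages_of_LU3` converted into value information — `min v(ca T_M) ≤ N · v(g)`
for an element `g` of a regular ring between `T_m` and `T_M`. [this work; cite: CossartPiltant2019, Thm. 1.1 with §4.1 (LU)] -/
theorem exh_excEquation (hLU3 : CossartPiltant2019LU3.{0}) (p : ℕ) (hp : p.Prime)
    (k K : Type) [Field k] [CharP k p] [Field K] [Algebra k K] (O : ValuationSubring K) (A : Subalgebra k K)
    (hk : ∀ c : k, algebraMap k K c ∈ O) (hA : A.FG) (hfr : IsFractionRing ↥A K) (hAO : A.toSubring ≤ O.toSubring)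
    (htr : Algebra.trdeg k K ≤ 3) (hexh : ∀ x : K, x ∈ O → ∃ m : ℕ, x ∈ tower O A m) (m : ℕ) :
    (∃ M : ℕ, IsRegularLocalRing ↥(tower O A M)) ∨
      ∃ M : ℕ, m < M ∧ ∃ R : Subalgebra k K, IsRegularLocalRing ↥R ∧ tower O A m ≤ R ∧ R ≤ tower O A M ∧
        ∃ g : K, g ∈ R ∧ g ≠ 0 ∧ O.valuation g < 1 ∧ ∃ N : ℕ, 0 < N ∧ g ^ N ∈ ca (tower O A M) := by
  obtain ⟨R, hreg, hRfr, hRO, hlocR, hTR, M₀, hM⟩ :=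
    Interlacing.exists_regular_between_stages_of_LU3 hLU3 p hp k K O A hk hA hfr hAO htr hexh m
  have hRM : R ≤ tower O A (max M₀ (m + 1)) := hM _ (le_max_left _ _)
  rcases excEquation_pow_mem_ca p hp k K O A hk hA hfr hAO hreg hRfr hRO hlocR hRM with h | ⟨g, hgR, hg0, hvg, N, hN, hgN⟩
  · exact Or.inl ⟨_, h⟩
  · exact Or.inr ⟨max M₀ (m + 1), lt_of_lt_of_le (Nat.lt_succ_self m) (le_max_right _ _), R, hreg, hTR, hRM,
      g, hgR, hg0, hvg, N, hN, hgN⟩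

/-- **At Exh3's binders** (`tr.deg_k K = 3`, the tower exhausts `O`; via `Beta1Trdeg3.exh3_interlaced`): the same dichotomy.
[this work; cite: CossartPiltant2019, Thm. 1.1 with §4.1 (LU)] -/
theorem exh3_excEquation (hLU3 : CossartPiltant2019LU3.{0}) (p : ℕ) (hp : p.Prime)
    (k K : Type) [Field k] [CharP k p] [Field K] [Algebra k K] (O : ValuationSubring K) (A : Subalgebra k K)
    (hk : ∀ c : k, algebraMap k K c ∈ O) (hA : A.FG) (hfr : IsFractionRing ↥A K) (hAO : A.toSubring ≤ O.toSubring)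
    (htr3 : Algebra.trdeg k K = 3) (hexh : ∀ x : K, x ∈ O → ∃ m : ℕ, x ∈ tower O A m) (m : ℕ) :
    (∃ M : ℕ, IsRegularLocalRing ↥(tower O A M)) ∨
      ∃ M : ℕ, m < M ∧ ∃ R : Subalgebra k K, IsRegularLocalRing ↥R ∧ tower O A m ≤ R ∧ R ≤ tower O A M ∧
        ∃ g : K, g ∈ R ∧ g ≠ 0 ∧ O.valuation g < 1 ∧ ∃ N : ℕ, 0 < N ∧ g ^ N ∈ ca (tower O A M) :=
  exh_excEquation hLU3 p hp k K O A hk hA hfr hAO (le_of_eq htr3) hexh m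

end Summit.ResolutionOfSingularities.ResolutionOfSingularities.Theorems.NoZeno.ExcEquation

end
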